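import Summits.Ventures.PercRepro.RankLevelSetLevelSixT22Free7TwoTri
import Summits.Ventures.PercRepro.RankLevelSetLevelSixArithOneTriSq22F7

/-!
# PercRepro — THE COLOOP-FREE CELL `(22, 7)`: AT MOST ONE TRIANGLE, AND THE SPLIT (p8 g12, S3)

`proofs/P8-G12-LEVER22.md` §2. `c025_core_six_t22_free7_onetri`: the existing cell `sq27di2v` at `(22, 7)` with `c₃ = 1`
(ratio `0.905`); `c025_core_six_t22_free7`: every coloop-free `e`-free core of rank `22` and corank `7` — two distinct
triangles (`c025_core_six_t22_free7_twotri`, THE CONFINEMENT LEMMA) or at most one. Axioms: standard.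
-/

open scoped Matroid

namespace PercRepro

namespace ThmN

open Set

variable {α : Type}

set_option maxHeartbeats 1600000 in
/-- **THE COLOOP-FREE CELL `(22, 7)` WITH AT MOST ONE TRIANGLE** (the existing cell `sq27di2v`, `c₃ = 1`). -/
theorem c025_core_six_t22_free7_onetri (M : Matroid α) [M.Finite] (hcf : ∀ e ∈ M.E, ¬ M.IsColoop e)
    (hR : M.eRank = (22 : ℕ∞)) (hn : M.E.ncard = 22 + 7)
    (hfree : ∀ e ∈ M.E, ∃ A ⊆ M.E \ {e}, e ∉ M.closure A ∧ e ∉ M.closure ((M.E \ {e}) \ A))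
    (hs3 : {C : Set α | M.IsCircuit C ∧ C.ncard = 3}.ncard ≤ 1) :
    RLS M 22 6 := by
  classical
  have hR' : M.eRank = ((22 : ℕ) : ℕ∞) := hR
  have hd : M.E.encard = M.eRank + (7 : ℕ) := by
    rw [hR, ← M.ground_finite.cast_ncard_eq, hn]
    push_cast
    ring
  have hflat6 : ∀ X ⊆ M.E, M.eRk X ≤ ((6 : ℕ) : ℕ∞) → X.ncard ≤ 12 :=
    fun X hX hr => ncard_le_five_add_of_coloopFree M hcf hR' hn (by omega) hX (by exact_mod_cast hr)
  have hflat5 : ∀ X ⊆ M.E, M.eRk X ≤ ((6 - 1 : ℕ) : ℕ∞) → X.ncard ≤ 11 :=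
    fun X hX hr => ncard_le_four_add_of_coloopFree M hcf hR' hn (by omega) hX hr
  have hUG : (Matroid.UG M 6 7).ncard ≤ 0 := by
    rw [UG_eq_empty_of_cap M hflat6 (by norm_num)]; simp
  have hUH : (Matroid.UH M 6 7).ncard ≤ 0 := by
    rw [Matroid.UH_eq_empty (M := M) (q := 6) (ν₁ := 7) hflat5 (by norm_num)]; simp
  have hΦ : phiK 22 6 ≤ (2 : ℚ) ^ (22 + 6) / (((22 + 6).choose 6 : ℕ) : ℚ) := phiK_le_two_pow_div_six 22
  rw [RLS_iff]
  exact c025_core_six_heavy_cell_sq27di2v M 22 7 7 0 0 0 10000 200 13 253 42 1 582 1044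
      ((22 + 6).choose 6) (Nat.choose_pos (by omega)) (phiK 22 6) hΦ (by norm_num) (by omega)
      (by norm_num) hUG hUH (by omega) (Or.inl (by norm_num)) (by norm_num) (by norm_num) (by norm_num)
      hs3
      ((S1.ncard_fourCircuits_le_gb14 7 M hfree hd 29 (by rw [coloops_eq_empty_of_forall M hcf, Set.sdiff_empty, hn])).trans (by decide))
      (s5_cf_of M hfree hcf (d := 6) (by rw [hd]; norm_num) 29 210 253 (by norm_num) (by omega) (by decide) (by omega))
      (s6_cf_of M hfree hcf (d := 6) (by rw [hd]; norm_num) 29 462 582 (by norm_num) (by omega) (by decide) (by omega))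
      (s7_cf_of M hfree hcf (d := 6) (by rw [hd]; norm_num) 29 792 1044 (by norm_num) (by omega) (by decide) (by omega))
      (Or.inl tail_six_onetri_sq22F7) hR' hn hfree level_six_poly_onetri_sq22F7

/-- **THE COLOOP-FREE CELL `(22, 7)`**: two distinct triangles (THE CONFINEMENT LEMMA) or at most one. -/
theorem c025_core_six_t22_free7 (M : Matroid α) [M.Finite] (hcf : ∀ e ∈ M.E, ¬ M.IsColoop e)
    (hR : M.eRank = (22 : ℕ∞)) (hn : M.E.ncard = 22 + 7)
    (hfree : ∀ e ∈ M.E, ∃ A ⊆ M.E \ {e}, e ∉ M.closure A ∧ e ∉ M.closure ((M.E \ {e}) \ A)) :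
    RLS M 22 6 := by
  classical
  have hfin : {C : Set α | M.IsCircuit C ∧ C.ncard = 3}.Finite :=
    M.ground_finite.finite_subsets.subset (fun C hC => hC.1.subset_ground)
  by_cases h : 1 < {C : Set α | M.IsCircuit C ∧ C.ncard = 3}.ncard
  · obtain ⟨C₁, C₂, hC₁, hC₂, hne⟩ := (Set.one_lt_ncard_iff hfin).1 h
    exact c025_core_six_t22_free7_twotri M hcf hR hn hfree ⟨C₁, C₂, hC₁.1, hC₂.1, hC₁.2, hC₂.2, hne⟩
  · exact c025_core_six_t22_free7_onetri M hcf hR hn hfree (by omega)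

end ThmN

end PercRepro
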